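import Summits.FinalStateConjecture.FinalStateConjecture.Theorems.BartnikGapSettlingGapExhaustionPhotonShellNodeDefs
import Summits.FinalStateConjecture.FinalStateConjecture.Theorems.BartnikGapSettlingGapExhaustionNodeChartPackage
import Summits.FinalStateConjecture.FinalStateConjecture.Theorems.BartnikGapSettlingGapExhaustionLabelWindow
import Summits.FinalStateConjecture.FinalStateConjecture.Theorems.BartnikGapSettlingGapExhaustionIKLocalStepOutUniform
import Summits.FinalStateConjecture.FinalStateConjecture.Theorems.BartnikGapSettlingGapExhaustionKerrBandHigherRegularityUniform
import Summits.FinalStateConjecture.FinalStateConjecture.Theorems.BartnikGapSettlingGapExhaustionIsMetricOnMetricInCoords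
import Summits.FinalStateConjecture.FinalStateConjecture.Theorems.BartnikGapSettlingGapExhaustionContDiffOnPullbackField
import Summits.FinalStateConjecture.FinalStateConjecture.Theorems.BartnikGapSettlingGapExhaustionKillingCoordBridge
import Summits.FinalStateConjecture.FinalStateConjecture.Theorems.BartnikGapSettlingGapExhaustionKerrCoordKillingSweepSmoothOut
import Summits.FinalStateConjecture.FinalStateConjecture.Theorems.BartnikGapSettlingGapExhaustionContMDiffOnPushforwardField
import Summits.FinalStateConjecture.FinalStateConjecture.Theorems.BartnikGapSettlingGapExhaustionKillingPushforwardAt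
import Summits.FinalStateConjecture.FinalStateConjecture.Theorems.BartnikGapSettlingGapExhaustionRicAtChartKillingLocality
import Literature.Geometry.Lorentzian.KillingFieldLocalExtension
import Literature.Geometry.Lorentzian.ConnectionNaturality
import Literature.Geometry.Lorentzian.Isometry
import Literature.Geometry.Manifold.InjOnLocalDiffeomorphInverse
import HarnessLib

/-!
# Crux `GapExhaustion` (stmt-FinalStateConjecture-10808), line `photon-shell-pseudoconvexity`:
# the INWARD SWEEP S3 modulo Ionescu–Klainerman (`inwardSweep_of_IK`), landed over the node
# vocabulary `Theorems.PhotonShellNode`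

Route `BartnikGapSettling`; helper (`--supports stmt-FinalStateConjecture-10808`) of line lead
c13 (wave 1, stub `InwardSweepOfIK`). PORT, proof VERBATIM, of §3c `inwardSweep_of_IK` of the crux
skeleton `Cruxes/GapExhaustion/Lines/photon_shell_pseudoconvexity.lean` (rev c13, kernel-checked
there as workfile content): the statement `StubInwardSweep` (S3 of the node
`EternalSilentNearKerrIsKerr`) is INLINED as the conclusion, and the hypothesis is the landed
Literature named fact `IonescuKlainermanLocalExtension` (Ionescu–Klainerman, JAMS 26 (2013),
Thm 1.2; the skeleton's alias `IKLocalKillingExtension`), so that the skeleton's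
`theorem stub_inwardSweep (hIK) : StubInwardSweep := PhotonShellNode.inwardSweep_of_IK hIK`
typechecks by δ-unfolding. Content: a timelike Killing field given on a far zone `{r > R}`,
`R ≤ R₀`, of an eternal doubly-silent near-Kerr vacuum star chart extends as a Killing field down
to the outer photon-shell face `{r > r_ph⁻ + ε}`, by iterating the local extension theorem across
the cylinders `{r = c}`, `c ∈ [r_ph⁻ + ε, max R₀ (r_ph⁻ + ε) + 1]` (pseudo-convex outward in exact
Kerr), with ONE order `6` and ONE tolerance `δ` over the compact label window
`{m₀ ≤ M ≤ m₀⁻¹, |a| ≤ χ M}`. Bricks: `Theorems.stub_ikLocalStepOutU` (UN-6-out),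
`Theorems.stub_kerrBandHigherRegularityU` (UN-2), `farSilent_chartPackageU`,
`Theorems.stub_kerrCoordKillingSweepSmoothOut`, the pullback / pushforward bridges
(`stub_contDiffOn_pullbackField`, `stub_killingCoord_of_isKillingFieldOn`,
`stub_contMDiffOn_pushforwardField`, `stub_killing_pushforward_at`) and the Killing locality glue
(`killingLoc_isKillingFieldOn_congr/union`). [cite: IonescuKlainerman2013, Thm 1.2]
-/

noncomputable section

set_option maxSynthPendingDepth 3

-- D-0017: single-problem summit, `Summit.<S>.<S>.…` by design (cf. lakefile `weak.linter.dupNamespace`).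
set_option linter.dupNamespace false

namespace Summit.FinalStateConjecture.FinalStateConjecture.Theorems.PhotonShellNode

open Literature.Geometry.Lorentzian
open Set Filter
open scoped Manifold ContDiff Topology ENNReal

/-- **THE INWARD SWEEP S3 FROM IONESCU–KLAINERMAN (label-UNIFORM, start radius bounded by the
label-level `R₀` of the reshaped S2; sorry-free modulo the named fact
`IonescuKlainermanLocalExtension`).** Every constant is obtained UNIFORMLY over the compact label
window (`Theorems.isCompact_labelWindow`), from the label-uniform OUT bricks
`Theorems.stub_ikLocalStepOutU` (UN-6-out), `Theorems.stub_kerrBandHigherRegularityU` (UN-2),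
`farSilent_chartPackageU` (⇐ UC); band radii `r_lo(ℓ) = r_ph⁻(ℓ) + ε`,
`r_e(ℓ) = max R₀ r_lo(ℓ) + 1` continuous on the window (`Theorems.continuousOn_rPhMinus₂`); the
tube radius uses `c₀ − r₊ ≥ ε` and the mass enters the tolerance only through `max 1 (m₀⁻¹)⁶`.
The conclusion is VERBATIM the body of the skeleton's `StubInwardSweep`.
[folklore composition; cite: IonescuKlainerman2013, Thm 1.2] -/
theorem inwardSweep_of_IK : IonescuKlainermanLocalExtension →
  ∀ (χ κ₀ m₀ ε R₀ : ℝ), χ < 1 → 0 < κ₀ → 0 < m₀ → 0 < ε → ∃ (k : ℕ) (δ : ℝ), 0 < δ ∧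
    ∀ (𝓢 : Spacetime.{0} 4) [𝓢.metric.HasLeviCivita] (M a : ℝ)
      (Ψ : (starBG M a).domain → 𝓢.carrier) (t : 𝓢.carrier → ℝ),
      m₀ ≤ M → M ≤ m₀⁻¹ → |a| ≤ χ * M →
      SilentEternalNearKerr 𝓢 M a Ψ k δ κ₀ t →
      PericentresBeyond M a (rPhMinus M a) →
      ∀ (R : ℝ) (T : Π x : 𝓢.carrier, TangentSpace (𝓡 4) x), R ≤ R₀ →
        TimelikeKillingBeyond 𝓢 M a Ψ T R →
      ∃ (T' : Π x : 𝓢.carrier, TangentSpace (𝓡 4) x) (R' : ℝ),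
        𝓢.metric.toPseudoRiemannianMetric.IsKillingFieldOn T' (farZone 𝓢 M a Ψ (rPhMinus M a + ε)) ∧
        TimelikeKillingBeyond 𝓢 M a Ψ T' R' := by
  intro hIK χ κ₀ m₀ ε R₀ hχ hκ₀ hm₀ hε
  -- the compact label window
  obtain ⟨Kℓ, hKℓ⟩ : ∃ Kℓ : Set (ℝ × ℝ), Kℓ = {ℓ : ℝ × ℝ | m₀ ≤ ℓ.1 ∧ ℓ.1 ≤ m₀⁻¹ ∧
      |ℓ.2| ≤ χ * ℓ.1} := ⟨_, rfl⟩
  have hKc : IsCompact Kℓ := by rw [hKℓ]; exact Theorems.isCompact_labelWindow χ m₀ hm₀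
  have hlab : ∀ ℓ ∈ Kℓ, 0 < ℓ.1 ∧ |ℓ.2| < ℓ.1 := by
    intro ℓ hℓ
    rw [hKℓ] at hℓ
    obtain ⟨h1, -, h3⟩ := hℓ
    have hpos : 0 < ℓ.1 := hm₀.trans_le h1
    have h4 : χ * ℓ.1 < 1 * ℓ.1 := mul_lt_mul_of_pos_right hχ hpos
    exact ⟨hpos, by linarith⟩
  -- the band radii as continuous functions of the label
  have hrloc : ContinuousOn (fun ℓ : ℝ × ℝ => rPhMinus ℓ.1 ℓ.2 + ε) Kℓ :=
    (Theorems.continuousOn_rPhMinus₂.mono fun ℓ hℓ ↦ (hlab ℓ hℓ).1).add continuousOn_const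
  have hrec : ContinuousOn (fun ℓ : ℝ × ℝ => max R₀ (rPhMinus ℓ.1 ℓ.2 + ε) + 1) Kℓ :=
    (continuousOn_const.sup hrloc).add continuousOn_const
  have hbandK : ∀ ℓ ∈ Kℓ, Kerr.photonOrbitRadius ℓ.1 |ℓ.2| < rPhMinus ℓ.1 ℓ.2 + ε ∧
      rPhMinus ℓ.1 ℓ.2 + ε < max R₀ (rPhMinus ℓ.1 ℓ.2 + ε) + 1 := by
    intro ℓ _
    refine ⟨?_, by linarith [le_max_right R₀ (rPhMinus ℓ.1 ℓ.2 + ε)]⟩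
    show Kerr.photonOrbitRadius ℓ.1 |ℓ.2| < Kerr.photonOrbitRadius ℓ.1 |ℓ.2| + ε
    linarith
  have hbandK' : ∀ ℓ ∈ Kℓ, Kerr.rPlus ℓ.1 ℓ.2 < rPhMinus ℓ.1 ℓ.2 + ε ∧
      rPhMinus ℓ.1 ℓ.2 + ε ≤ max R₀ (rPhMinus ℓ.1 ℓ.2 + ε) + 1 := by
    intro ℓ hℓ
    exact ⟨by linarith [rPlus_lt_rPhMinus (a := ℓ.2) (hlab ℓ hℓ).1], (hbandK ℓ hℓ).2.le⟩
  -- UN-6-out: ONE tolerance `δ₆` and ONE radius map `ρ ↦ ρ'` on the bands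
  obtain ⟨δ₆, hδ₆, H6⟩ := Theorems.stub_ikLocalStepOutU hIK Kℓ (fun ℓ => rPhMinus ℓ.1 ℓ.2 + ε)
    (fun ℓ => max R₀ (rPhMinus ℓ.1 ℓ.2 + ε) + 1) hKc hlab hrloc hrec hbandK
  -- UN-2 (order 0): ONE tube radius and Lipschitz constant of `r` near the cylinders
  obtain ⟨ρ₀, L₃, ν, CK, hρ₀, hL₃, -, -, hbandU⟩ :=
    Theorems.stub_kerrBandHigherRegularityU Kℓ (fun ℓ => rPhMinus ℓ.1 ℓ.2 + ε)
      (fun ℓ => max R₀ (rPhMinus ℓ.1 ℓ.2 + ε) + 1) 0 hKc hlab hrloc hrec hbandK'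
  have hε4 : 0 < ε / 4 := by positivity
  obtain ⟨ρ, hρ⟩ : ∃ ρ : ℝ, ρ = min ρ₀ (min (ε / 4) (1 / 4) / (L₃ + 1)) := ⟨_, rfl⟩
  have hL₃1 : 0 < L₃ + 1 := by linarith
  have hρpos : 0 < ρ := by
    rw [hρ]; exact lt_min hρ₀ (div_pos (lt_min hε4 (by norm_num)) hL₃1)
  have hρρ₀ : ρ ≤ ρ₀ := by rw [hρ]; exact min_le_left _ _
  have hρLε : ρ ≤ min (ε / 4) (1 / 4) / (L₃ + 1) := by rw [hρ]; exact min_le_right _ _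
  obtain ⟨ρ', hρ', H6'U⟩ := H6 ρ hρpos
  obtain ⟨δc, hδc, HchartU⟩ := farSilent_chartPackageU Kℓ hKc hlab
  -- the tolerance (the mass enters only through `max 1 (m₀⁻¹)⁶`)
  obtain ⟨CM, hCM⟩ : ∃ CM : ℝ, CM = max 1 (m₀⁻¹ ^ 6) := ⟨_, rfl⟩
  have hCM1 : 1 ≤ CM := by rw [hCM]; exact le_max_left _ _
  have hCMpos : 0 < CM := one_pos.trans_le hCM1
  have hCMwin : ∀ M : ℝ, m₀ ≤ M → ∀ j : ℕ, j ≤ 6 → (M ^ j)⁻¹ ≤ CM := by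
    intro M hM j hj
    have hMpos : 0 < M := hm₀.trans_le hM
    rcases le_or_gt 1 M with hM1 | hM1
    · exact (inv_le_one_of_one_le₀ (one_le_pow₀ hM1)).trans hCM1
    · rw [hCM]; refine le_trans ?_ (le_max_right _ _)
      rw [← inv_pow]
      have h1 : 1 ≤ M⁻¹ := (one_le_inv₀ hMpos).2 hM1.le
      have h2 : M⁻¹ ≤ m₀⁻¹ := (inv_le_inv₀ hMpos hm₀).2 hM
      exact (pow_le_pow_right₀ h1 hj).trans (pow_le_pow_left₀ (inv_nonneg.2 hMpos.le) h2 6)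
  obtain ⟨δ, hδ⟩ : ∃ δ : ℝ, δ = min δc (δ₆ / CM) := ⟨_, rfl⟩
  have hδpos : 0 < δ := by rw [hδ]; exact lt_min hδc (div_pos hδ₆ hCMpos)
  have hδc' : δ ≤ δc := by rw [hδ]; exact min_le_left _ _
  have hδ6' : δ * CM ≤ δ₆ := by
    have h : δ ≤ δ₆ / CM := by rw [hδ]; exact min_le_right _ _
    rwa [le_div_iff₀ hCMpos] at h
  refine ⟨6, δ, hδpos, ?_⟩
  intro 𝓢 _ M a Ψ t hM hM' ha hS _hP R T hRR₀ hT
  have hMpos : 0 < M := hm₀.trans_le hM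
  have ha' : |a| < M := by
    have h1 : χ * M < 1 * M := mul_lt_mul_of_pos_right hχ hMpos
    linarith
  have hrpM : M ≤ Kerr.rPlus M a := le_add_of_nonneg_right (Real.sqrt_nonneg _)
  have hℓK : (M, a) ∈ Kℓ := by rw [hKℓ]; exact ⟨hM, hM', ha⟩
  -- the band of the sweep: from `c₁ = max R₀ c₀ + 1` down to `c₀ = r_ph⁻ + ε`
  obtain ⟨c₀, hc₀⟩ : ∃ c₀ : ℝ, c₀ = rPhMinus M a + ε := ⟨_, rfl⟩
  obtain ⟨c₁, hc₁⟩ : ∃ c₁ : ℝ, c₁ = max R₀ c₀ + 1 := ⟨_, rfl⟩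
  have hrp : Kerr.rPlus M a < c₀ := by rw [hc₀]; linarith [rPlus_lt_rPhMinus (a := a) hMpos]
  have hph : Kerr.photonOrbitRadius M |a| < c₀ := by rw [hc₀]; show _ < Kerr.photonOrbitRadius M |a| + ε; linarith
  have hc₀M : M < c₀ := hrpM.trans_lt hrp
  have hc₀pos : 0 < c₀ := hMpos.trans hc₀M
  have hac₀ : |a| ≤ c₀ := by linarith
  have hc₀c₁ : c₀ < c₁ := by rw [hc₁]; linarith [le_max_right R₀ c₀]
  have hR₀c₁ : R₀ < c₁ := by rw [hc₁]; linarith [le_max_left R₀ c₀]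
  -- the uniform facts at the label `(M, a)`
  have H6' := H6'U (M, a) hℓK
  have hband := hbandU (M, a) hℓK
  have Hchart := HchartU (M, a) hℓK
  dsimp only at H6' hband Hchart
  rw [← hc₀] at H6' hband
  rw [← hc₁] at H6' hband
  have hCMj : ∀ j : ℕ, j ≤ 6 → (M ^ j)⁻¹ ≤ CM := hCMwin M hM
  have hgap₀ : 0 < (c₀ - Kerr.rPlus M a) / 4 := by linarith
  have hρL : ρ ≤ min ((c₀ - Kerr.rPlus M a) / 4) (1 / 4) / (L₃ + 1) := by
    refine hρLε.trans (div_le_div_of_nonneg_right (min_le_min ?_ le_rfl) hL₃1.le)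
    rw [hc₀]; linarith [rPlus_lt_rPhMinus (a := a) hMpos]
  have hFS : FarSilentNearKerr 𝓢 M a Ψ 6 δ := hS.1
  have hRF : 𝓢.metric.toPseudoRiemannianMetric.IsRicciFlat := hFS.1
  obtain ⟨Φ, hΦΨ, hdom, hΦs, hΦe, hΦinj, hinjd, hclose⟩ := Hchart 𝓢 Ψ 6 δ hδpos.le hδc' hFS
  have hmem : ∀ z : E4, M < Kerr.radius a z → z ∈ ((starBG M a).domain : Set E4) := by
    intro z hz; rw [← hdom]; exact hz
  -- the sets of the construction
  obtain ⟨W, hWdef⟩ : ∃ W : Set E4, W = {z | M < Kerr.radius a z} := ⟨_, rfl⟩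
  obtain ⟨D, hDdef⟩ : ∃ D : Set E4,
      D = {y | (Kerr.rPlus M a + c₀) / 2 < Kerr.radius a y ∧ Kerr.radius a y < c₁ + 1} := ⟨_, rfl⟩
  have hW : IsOpen W := by rw [hWdef]; exact isOpen_lt continuous_const (Kerr.continuous_radius a)
  have hD : IsOpen D := by
    rw [hDdef]
    exact (isOpen_lt continuous_const (Kerr.continuous_radius a)).inter
      (isOpen_lt (Kerr.continuous_radius a) continuous_const)
  have hDW : D ⊆ W := by
    intro y hy; rw [hDdef] at hy; rw [hWdef]; show M < Kerr.radius a y; linarith [hy.1]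
  have hgtc : ∀ c : ℝ, IsOpen {y : E4 | c < Kerr.radius a y} := fun c ↦
    isOpen_lt continuous_const (Kerr.continuous_radius a)
  have hW₀ : IsOpen (D ∩ {y | c₁ < Kerr.radius a y}) := hD.inter (hgtc c₁)
  have hW₁ : IsOpen (D ∩ {y | c₀ < Kerr.radius a y}) := hD.inter (hgtc c₀)
  have hΦsW : ContMDiffOn 𝓘(ℝ, E4) (𝓡 4) ∞ Φ W := by rw [hWdef]; exact hΦs
  have hinjW : ∀ y ∈ W, Function.Injective (mfderiv 𝓘(ℝ, E4) (𝓡 4) Φ y) := by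
    intro y hy; rw [hWdef] at hy; exact hinjd y hy
  have hInjW : InjOn Φ W := by rw [hWdef]; exact hΦinj
  have hGmet : MetricCoord.IsMetricOn (𝓢.metricInCoords Φ) W :=
    Theorems.stub_isMetricOn_metricInCoords 𝓢 Φ W hW hΦsW hinjW
  have hDr : ∀ y ∈ D, |a| ≤ Kerr.radius a y ∧ 0 < Kerr.radius a y := by
    intro y hy; rw [hDdef] at hy
    exact ⟨by linarith [hy.1], by linarith [hy.1]⟩
  -- chart points of radius `> R` lie in `farZone R`
  have himg_far : ∀ (R₁ : ℝ) (y : E4), M < Kerr.radius a y → R₁ < Kerr.radius a y →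
      Φ y ∈ farZone 𝓢 M a Ψ R₁ := by
    intro R₁ y hyM hyR
    exact ⟨⟨y, hmem y hyM⟩, hyR, (hΦΨ ⟨y, hmem y hyM⟩).symm⟩
  -- the scri-side field pulled back: a coordinate Killing field on `W₀ = D ∩ {r > c₁}`
  have hW₀sub : Φ '' (D ∩ {y | c₁ < Kerr.radius a y}) ⊆ farZone 𝓢 M a Ψ R := by
    rintro _ ⟨y, ⟨hyD, hyc⟩, rfl⟩
    have hyM : M < Kerr.radius a y := by rw [hWdef] at hDW; exact hDW hyD
    exact himg_far R y hyM (by show R < Kerr.radius a y; linarith [show c₁ < Kerr.radius a y from hyc])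
  have hTW₀ : 𝓢.metric.toPseudoRiemannianMetric.IsKillingFieldOn T (Φ '' (D ∩ {y | c₁ < Kerr.radius a y})) :=
    hT.1.mono hW₀sub
  have hk₀cd : ContDiffOn ℝ ∞ (fun y : E4 => (mfderiv 𝓘(ℝ, E4) (𝓡 4) Φ y).inverse (T (Φ y)))
      (D ∩ {y | c₁ < Kerr.radius a y}) :=
    Theorems.stub_contDiffOn_pullbackField 𝓢 Φ _ T hW₀ (hΦsW.mono (inter_subset_left.trans hDW))
      (fun y hy ↦ hinjW y (hDW hy.1)) hTW₀.1
  have hk₀eq := (Theorems.stub_killingCoord_of_isKillingFieldOn 𝓢 Φ _ T hW₀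
    (hΦsW.mono (inter_subset_left.trans hDW)) (fun y hy ↦ hinjW y (hDW hy.1)) hTW₀).2
  -- the `ρ`-balls around the cylinders lie in the arena
  have hballs : ∀ c ∈ Icc c₀ c₁, ∀ x : E4, Kerr.radius a x = c → Metric.ball x ρ ⊆ D := by
    intro c hc x hx y hy
    rw [Metric.mem_ball, dist_eq_norm] at hy
    have hw : ‖y - x‖ ≤ ρ₀ := hy.le.trans hρρ₀
    obtain ⟨-, hlip, -⟩ := hband x (hx ▸ hc.1) (hx ▸ hc.2) (y - x) hw
    rw [add_sub_cancel, hx] at hlip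
    have h1 : L₃ * ‖y - x‖ ≤ L₃ * (min ((c₀ - Kerr.rPlus M a) / 4) (1 / 4) / (L₃ + 1)) :=
      mul_le_mul_of_nonneg_left (hy.le.trans hρL) hL₃
    have h2 : L₃ * (min ((c₀ - Kerr.rPlus M a) / 4) (1 / 4) / (L₃ + 1)) ≤
        min ((c₀ - Kerr.rPlus M a) / 4) (1 / 4) := by
      rw [mul_div_assoc']
      rw [div_le_iff₀ hL₃1]
      nlinarith [le_min hgap₀.le (by norm_num : (0:ℝ) ≤ 1 / 4)]
    have h3 := min_le_left ((c₀ - Kerr.rPlus M a) / 4) (1 / 4)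
    have h4 := min_le_right ((c₀ - Kerr.rPlus M a) / 4) (1 / 4)
    have h5 := abs_le.1 hlip
    rw [hDdef]
    constructor
    · show (Kerr.rPlus M a + c₀) / 2 < Kerr.radius a y
      linarith [hc.1, h5.1]
    · show Kerr.radius a y < c₁ + 1
      linarith [hc.2, h5.2]
  -- the closeness hypothesis of N-6-out from the weighted bounds
  have hclose6 : ∀ z : E4, (Kerr.rPlus M a + c₀) / 2 ≤ Kerr.radius a z → Kerr.radius a z ≤ c₁ + 1 →
      ∀ j : ℕ, j ≤ 6 → ‖iteratedFDeriv ℝ j (fun z => 𝓢.metricInCoords Φ z - Kerr.bilin M a z) z‖ ≤ δ₆ := by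
    intro z hz _ j hj
    have hzM : M < Kerr.radius a z := by linarith
    refine (hclose z hzM j hj).trans ?_
    calc δ * M / Kerr.radius a z ^ (j + 1) ≤ δ * M / M ^ (j + 1) := by
          apply div_le_div_of_nonneg_left (by positivity) (by positivity)
          exact pow_le_pow_left₀ hMpos.le hzM.le _
      _ = δ * (M ^ j)⁻¹ := by field_simp; ring
      _ ≤ δ * CM := mul_le_mul_of_nonneg_left (hCMj j hj) hδpos.le
      _ ≤ δ₆ := hδ6'
  have hloc := H6' 𝓢 Φ hRF hΦs hΦe hinjd hclose6
  -- the inward sweep from `c₁` down to `c₀`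
  obtain ⟨kf, hkfcd, hkfeq, hkfagree⟩ := Theorems.stub_kerrCoordKillingSweepSmoothOut (𝓢.metricInCoords Φ) W D a
    c₀ c₁ ρ ρ' (fun y : E4 => (mfderiv 𝓘(ℝ, E4) (𝓡 4) Φ y).inverse (T (Φ y))) hGmet hD hDW hc₀c₁.le
    hc₀pos hac₀ hρ' hρpos hDr hballs hloc hk₀cd hk₀eq
  -- N-5: the swept field as a manifold Killing field on `Φ '' W₁`, `W₁ = D ∩ {r > c₀}`
  have hW₁W : D ∩ {y | c₀ < Kerr.radius a y} ⊆ W := inter_subset_left.trans hDW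
  have hinjW₁ : InjOn Φ (D ∩ {y | c₀ < Kerr.radius a y}) := hInjW.mono hW₁W
  obtain ⟨Kp, hKp⟩ : ∃ Kp : Π p : 𝓢.carrier, TangentSpace (𝓡 4) p, Kp = fun p : 𝓢.carrier ↦
      (mfderiv 𝓘(ℝ, E4) (𝓡 4) Φ (Function.invFunOn Φ (D ∩ {y | c₀ < Kerr.radius a y}) p)
        (kf (Function.invFunOn Φ (D ∩ {y | c₀ < Kerr.radius a y}) p)) : TangentSpace (𝓡 4) p) := ⟨_, rfl⟩
  have hKpsm := Theorems.stub_contMDiffOn_pushforwardField 𝓢 Φ _ kf hW₁ (hΦsW.mono hW₁W)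
    (fun y hy ↦ hinjW y (hW₁W hy)) hinjW₁ hkfcd
  have hKpKil : 𝓢.metric.toPseudoRiemannianMetric.IsKillingFieldOn Kp (Φ '' (D ∩ {y | c₀ < Kerr.radius a y})) := by
    rw [hKp]
    refine ⟨hKpsm, ?_⟩
    rintro _ ⟨y, hy, rfl⟩ Y Z
    have hkd : DifferentiableAt ℝ kf y :=
      ((hkfcd y hy).contDiffAt (hW₁.mem_nhds hy)).differentiableAt (by simp)
    exact Theorems.stub_killing_pushforward_at 𝓢 Φ _ kf hW₁ (hΦsW.mono hW₁W)
      (fun y hy ↦ hinjW y (hW₁W hy)) hinjW₁ hKpsm y hy hkd (hkfeq y hy) Y Z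
  -- `Kp = T` on `Φ '' W₀`
  have hKpT : ∀ y ∈ D ∩ {y | c₁ < Kerr.radius a y}, Kp (Φ y) = T (Φ y) := by
    intro y hy
    have hy1 : y ∈ D ∩ {y | c₀ < Kerr.radius a y} :=
      ⟨hy.1, lt_trans hc₀c₁ (show c₁ < Kerr.radius a y from hy.2)⟩
    have hinv : (mfderiv 𝓘(ℝ, E4) (𝓡 4) Φ y).IsInvertible :=
      PseudoRiemannianMetric.isInvertible_mfderiv_of_injective (Φ := Φ) rfl (hinjW y (hDW hy.1))
    rw [hKp]
    show mfderiv 𝓘(ℝ, E4) (𝓡 4) Φ (Function.invFunOn Φ (D ∩ {y | c₀ < Kerr.radius a y}) (Φ y))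
        (kf (Function.invFunOn Φ (D ∩ {y | c₀ < Kerr.radius a y}) (Φ y))) = T (Φ y)
    rw [Literature.Geometry.Manifold.invFunOn_apply hinjW₁ hy1, hkfagree hy]
    exact hinv.self_apply_inverse _
  -- the glued field: pushforward on `Φ '' W₁`, `T` elsewhere
  classical
  obtain ⟨T', hT'⟩ : ∃ T' : Π p : 𝓢.carrier, TangentSpace (𝓡 4) p, T' = fun p : 𝓢.carrier ↦
      if p ∈ Φ '' (D ∩ {y | c₀ < Kerr.radius a y}) then Kp p else T p := ⟨_, rfl⟩
  obtain ⟨U₂, hU₂⟩ : ∃ U₂ : Set E4, U₂ = {y | c₁ + 1 / 2 < Kerr.radius a y} := ⟨_, rfl⟩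
  have hU₂W : U₂ ⊆ W := by intro y hy; rw [hU₂] at hy; rw [hWdef]; show M < Kerr.radius a y; linarith [show c₁ + 1 / 2 < Kerr.radius a y from hy]
  have hU₂open : IsOpen U₂ := by rw [hU₂]; exact hgtc _
  have hT'U₂ : ∀ y ∈ U₂, T' (Φ y) = T (Φ y) := by
    intro y hy
    rw [hT']
    by_cases h : Φ y ∈ Φ '' (D ∩ {y | c₀ < Kerr.radius a y})
    · obtain ⟨y₁, hy₁, hyy⟩ := h
      have heq : y₁ = y := hInjW (hW₁W hy₁) (hU₂W hy) hyy
      subst heq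
      simp only [show Φ y₁ ∈ Φ '' (D ∩ {y | c₀ < Kerr.radius a y}) from ⟨y₁, hy₁, rfl⟩, if_true]
      refine hKpT y₁ ⟨hy₁.1, ?_⟩
      show c₁ < Kerr.radius a y₁
      rw [hU₂] at hy; linarith [show c₁ + 1 / 2 < Kerr.radius a y₁ from hy]
    · simp only [h, if_false]
  have hbij : ∀ U : Set E4, U ⊆ W → IsOpen U → IsOpen (Φ '' U) := fun U hUW hU ↦
    Literature.Geometry.Manifold.isOpen_image_of_bijective_mfderiv hU (hΦsW.mono hUW) fun z hz ↦
      mfderiv_bijective_of_injective (hinjW z (hUW hz)) rfl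
  have hO₁ : 𝓢.metric.toPseudoRiemannianMetric.IsKillingFieldOn T' (Φ '' (D ∩ {y | c₀ < Kerr.radius a y})) := by
    refine Theorems.killingLoc_isKillingFieldOn_congr 𝓢 _ Kp T' (hbij _ hW₁W hW₁) (fun p hp ↦ ?_) hKpKil
    rw [hT']
    simp only [hp, if_true]
  have hU₂far : Φ '' U₂ ⊆ farZone 𝓢 M a Ψ R := by
    rintro _ ⟨y, hy, rfl⟩
    have hyM : M < Kerr.radius a y := by rw [hWdef] at hU₂W; exact hU₂W hy
    rw [hU₂] at hy
    exact himg_far R y hyM (by show R < Kerr.radius a y; linarith [show c₁ + 1 / 2 < Kerr.radius a y from hy])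
  have hO₂ : 𝓢.metric.toPseudoRiemannianMetric.IsKillingFieldOn T' (Φ '' U₂) := by
    refine Theorems.killingLoc_isKillingFieldOn_congr 𝓢 _ T T' (hbij U₂ hU₂W hU₂open) ?_ (hT.1.mono hU₂far)
    rintro _ ⟨y, hy, rfl⟩
    exact hT'U₂ y hy
  have hunion := Theorems.killingLoc_isKillingFieldOn_union 𝓢 _ _ T' (hbij _ hW₁W hW₁) (hbij U₂ hU₂W hU₂open) hO₁ hO₂
  refine ⟨T', c₁ + 2, hunion.mono ?_, hunion.mono ?_, fun x hx ↦ ?_⟩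
  · -- `farZone (r_ph⁻ + ε) ⊆ Φ '' W₁ ∪ Φ '' U₂`
    rintro _ ⟨x, hxc, rfl⟩
    rw [← hc₀] at hxc
    have hxM : M < Kerr.radius a x.1 := by
      have : (x.1 : E4) ∈ ((starBG M a).domain : Set E4) := x.2
      rw [← hdom] at this; exact this
    by_cases hxr : Kerr.radius a x.1 < c₁ + 1
    · refine Or.inl ⟨x.1, ⟨?_, hxc⟩, hΦΨ x⟩
      rw [hDdef]; exact ⟨by linarith [show c₀ < Kerr.radius a x.1 from hxc], hxr⟩
    · refine Or.inr ⟨x.1, ?_, hΦΨ x⟩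
      rw [hU₂]; show c₁ + 1 / 2 < Kerr.radius a x.1; linarith
  · -- `farZone (c₁ + 2) ⊆ Φ '' U₂`
    rintro _ ⟨x, hxc, rfl⟩
    refine Or.inr ⟨x.1, ?_, hΦΨ x⟩
    rw [hU₂]; show c₁ + 1 / 2 < Kerr.radius a x.1
    linarith [show c₁ + 2 < Kerr.radius a x.1 from hxc]
  · -- `T'` is `T`, timelike, beyond `c₁ + 2`
    have hxU : x.1 ∈ U₂ := by rw [hU₂]; show c₁ + 1 / 2 < Kerr.radius a x.1; linarith
    rw [← hΦΨ x, hT'U₂ x.1 hxU, hΦΨ x]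
    exact hT.2 x (by linarith)

end Summit.FinalStateConjecture.FinalStateConjecture.Theorems.PhotonShellNode

end
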